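import Summits.AtomisticToContinuum.HydrodynamicLimit.Theorems.InfluenceLocality.Negative.IgnitionTemplates
import Literature.Analysis.FluidPDE.HardSphereUniqueness
import Literature.MathematicalPhysics.KineticTheory.HardSphereCanonicalTorus
import Mathlib.MeasureTheory.Measure.Lebesgue.VolumeOfBalls
import Mathlib.Analysis.Complex.Exponential

/-!
# `InfluenceLocality` (stmt-AtomisticToContinuum-13916) — ignition templates: statics

Sorry-free statics of the refutation line `ignition-cascade-refutation` (lead c1, 2026-08-16):

* the tolerance box is a measurable product set of Liouville volume `∏ᵢ (4π/3)rxᵢ³ · (4π/3)rvᵢ³`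
  (`volume_templateBox`, chart range `rxᵢ < 1/2` of the minimal image);
* **Gibbs mass of a box** `G_N(box) ≥ ∏ᵢ boxWeightᵢ` for constant profiles `a = θ = 1, u₀ = 0`,
  `σ ≤ 1/2` (`gibbs_templateBox_ge`: the canonical density is `Z⁻¹ ∏ M(vᵢ) ≥ ∏ M(vᵢ)`, `Z ≤ 1`);
* **cost arithmetic** `(N+1)! ∏ᵢ boxWeightᵢ ≥ e^{-(C + κ)(N+1)}` under the cost axiom
  (`exp_le_factorial_mul_prod_boxWeight`, crude Stirling `nⁿ ≤ eⁿ n!`);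
* relabelled boxes are disjoint, and the symmetrised box has mass `≥ (N+1)! ∏ᵢ boxWeightᵢ`
  (`gibbs_symBox_ge`) — the symmetrisation is what turns the factorially small labelled box into an
  exponentially small event.

Nothing here asserts a Theses decl positively.
-/

namespace Summit.AtomisticToContinuum.HydrodynamicLimit.Theorems.InfluenceLocality.Negative

open MeasureTheory Set
open scoped Classical ENNReal
open Literature.Analysis.FluidPDE Literature.MathematicalPhysics.KineticTheory
open Summit.AtomisticToContinuum.HydrodynamicLimit.Theses.AntiMazurCoboundaries (InfluenceLocality)

noncomputable section

/-! ## The tolerance box: product structure, measurability, volume -/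

/-- The tolerance box is a product of one-particle boxes. -/
theorem templateBox_eq_pi {n : ℕ} (p : Fin n → T3) (w : Fin n → V3) (rx rv : Fin n → ℝ) :
    templateBox p w rx rv = Set.univ.pi fun i =>
      {x : T3 | Torus.euclidDist x (p i) ≤ rx i} ×ˢ Metric.closedBall (w i) (rv i) := by
  ext z
  simp [templateBox, Set.mem_pi, Set.mem_prod, Metric.mem_closedBall, dist_eq_norm]

/-- Minimal-image balls are measurable. -/
theorem measurableSet_euclidDist_le (y : T3) (r : ℝ) :
    MeasurableSet {x : T3 | Torus.euclidDist x y ≤ r} := by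
  have hm : Measurable fun x : T3 => Torus.euclidDist x y := by
    unfold Torus.euclidDist
    exact (Torus.measurable_reprSym.comp (measurable_id.sub_const y)).norm
  exact measurableSet_le hm measurable_const

/-- The tolerance box is measurable. -/
theorem measurableSet_templateBox {n : ℕ} (p : Fin n → T3) (w : Fin n → V3) (rx rv : Fin n → ℝ) :
    MeasurableSet (templateBox p w rx rv) := by
  rw [templateBox_eq_pi]
  exact MeasurableSet.univ_pi fun i =>
    (measurableSet_euclidDist_le (p i) (rx i)).prod Metric.isClosed_closedBall.measurableSet

/-- The Liouville volume of the tolerance box: `∏ᵢ (4π/3) rxᵢ³ · (4π/3) rvᵢ³` (for `rxᵢ < 1/2`, the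
chart range of the minimal image). -/
theorem volume_templateBox {n : ℕ} (p : Fin n → T3) (w : Fin n → V3) (rx rv : Fin n → ℝ)
    (hrx : ∀ i, rx i < 1 / 2) :
    volume (templateBox p w rx rv) = ∏ i, (ENNReal.ofReal (rx i) ^ 3 * ENNReal.ofReal (Real.pi * 4 / 3)) *
      (ENNReal.ofReal (rv i) ^ 3 * ENNReal.ofReal (Real.pi * 4 / 3)) := by
  haveI : SigmaFinite (volume : Measure (T3 × V3)) := by
    rw [Measure.volume_eq_prod]; infer_instance
  rw [templateBox_eq_pi, volume_pi, Measure.pi_pi]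
  refine Finset.prod_congr rfl fun i _ => ?_
  rw [Measure.volume_eq_prod, Measure.prod_prod, Torus.volume_euclidDist_le (hrx i),
    EuclideanSpace.volume_closedBall_fin_three, EuclideanSpace.volume_closedBall_fin_three]

/-- Perturbing both points: `d(y₁, y₂) - d(x₁, y₁) - d(x₂, y₂) ≤ d(x₁, x₂)`. -/
theorem euclidDist_sub_sub_le_T3 (x₁ x₂ y₁ y₂ : T3) :
    Torus.euclidDist y₁ y₂ - Torus.euclidDist x₁ y₁ - Torus.euclidDist x₂ y₂ ≤
      Torus.euclidDist x₁ x₂ := by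
  have h1 := euclidDist_triangle y₁ x₁ y₂
  have h2 := euclidDist_triangle x₁ x₂ y₂
  rw [Torus.euclidDist_comm y₁ x₁] at h1
  linarith

/-- Separated boxes lie in the hard-sphere domain. -/
theorem templateBox_subset_hardSphereDomain {n : ℕ} {p : Fin n → T3} {w : Fin n → V3}
    {rx rv : Fin n → ℝ} {ε : ℝ}
    (hsep : ∀ i j, i ≠ j → ε ≤ Torus.euclidDist (p i) (p j) - rx i - rx j) :
    templateBox p w rx rv ⊆ hardSphereDomain (Torus.geometry (Fin 3)) n ε := by
  intro z hz i j hij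
  rw [Torus.norm_geometry_sepVec]
  have h := euclidDist_sub_sub_le_T3 (z i).1 (z j).1 (p i) (p j)
  have hi := (hz i).1
  have hj := (hz j).1
  linarith [hsep i j hij]

/-! ## The Gibbs mass of a tolerance box -/

/-- The unit Maxwellian on a velocity ball is at least its value at the far rim. -/
theorem localMaxwellian_ge_of_mem_ball {w v : V3} {rv : ℝ} (hv : ‖v - w‖ ≤ rv) :
    (2 * Real.pi) ^ (-(3 : ℝ) / 2) * Real.exp (-(‖w‖ + rv) ^ 2 / 2) ≤
      localMaxwellian 1 1 (0 : V3) v := by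
  have hfin : (Module.finrank ℝ V3 : ℝ) = 3 := by
    simp [V3]
  unfold localMaxwellian
  rw [hfin, one_mul, mul_one, sub_zero, mul_one]
  refine mul_le_mul_of_nonneg_left (Real.exp_le_exp.2 ?_) (Real.rpow_nonneg (by positivity) _)
  have h1 : ‖v‖ ≤ ‖w‖ + rv := by
    calc ‖v‖ = ‖(v - w) + w‖ := by rw [sub_add_cancel]
      _ ≤ ‖v - w‖ + ‖w‖ := norm_add_le _ _
      _ ≤ ‖w‖ + rv := by linarith
  have h2 : ‖v‖ ^ 2 ≤ (‖w‖ + rv) ^ 2 := pow_le_pow_left₀ (norm_nonneg _) h1 2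
  linarith

/-- **Gibbs mass of a tolerance box** (constant profiles `a = θ = 1`, `u₀ = 0`, `σ ≤ 1/2`): at least
`∏ᵢ boxWeight (w i) (rx i) (rv i)` — the canonical density is `Z⁻¹ ∏ M(vᵢ) ≥ ∏ M(vᵢ)` on the box
(`Z ≤ 1`), and the Maxwellians are bounded below on the velocity balls. -/
theorem gibbs_templateBox_ge {σ : ℝ} (hσ2 : σ ≤ 1 / 2) {N : ℕ} (Φ : Flow σ N)
    {p : Fin (N + 1) → T3} {w : Fin (N + 1) → V3} {rx rv : Fin (N + 1) → ℝ}
    (hrx0 : ∀ i, 0 ≤ rx i) (hrx : ∀ i, rx i < 1 / 2) (hrv0 : ∀ i, 0 ≤ rv i)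
    (hsep : ∀ i j, i ≠ j → hsDiameter σ N ≤ Torus.euclidDist (p i) (p j) - rx i - rx j) :
    ENNReal.ofReal (∏ i, boxWeight (w i) (rx i) (rv i)) ≤
      gibbs σ 1 1 0 N Φ (templateBox p w rx rv) := by
  set B := templateBox p w rx rv with hB
  have hBm : MeasurableSet B := measurableSet_templateBox p w rx rv
  have hBD : B ⊆ hardSphereDomain (Torus.geometry (Fin 3)) (N + 1) (hsDiameter σ N) :=
    templateBox_subset_hardSphereDomain hsep
  -- the density on the box
  set m : Fin (N + 1) → ℝ := fun i =>
    (2 * Real.pi) ^ (-(3 : ℝ) / 2) * Real.exp (-(‖w i‖ + rv i) ^ 2 / 2) with hm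
  have hm0 : ∀ i, 0 ≤ m i := fun i => mul_nonneg (Real.rpow_nonneg (by positivity) _) (Real.exp_nonneg _)
  have hZpos : 0 < posPartition (fun _ : T3 => (1 : ℝ)) (hsDiameter σ N) (N + 1) :=
    posPartition_pos continuous_const (fun _ => one_pos) hσ2 N
  have hZle : posPartition (fun _ : T3 => (1 : ℝ)) (hsDiameter σ N) (N + 1) ≤ 1 := by
    -- (`𝕋³` has unit volume; cf. `EntropyBall.InfluenceLocality.posPartition_one_le_one`)
    unfold posPartition
    calc ∫ x, posWeight (fun _ : T3 => (1 : ℝ)) (hsDiameter σ N) (N + 1) x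
        ≤ ∫ _x : Fin (N + 1) → T3, (1 : ℝ) := by
          refine integral_mono (integrable_posWeight continuous_const (fun _ => zero_le_one) _ _)
            (integrable_const 1) fun x => ?_
          simpa using posWeight_le_pow (a₀ := fun _ : T3 => (1 : ℝ)) (fun _ => zero_le_one)
            (fun _ => le_rfl) (hsDiameter σ N) x
      _ = 1 := by simp
  have hdens : ∀ z ∈ B, (∏ i, m i) ≤
      canonicalDensity (Torus.geometry (Fin 3)) (hsDiameter σ N) (N + 1)
        (localGibbsProfile (fun _ => (1 : ℝ)) (fun _ => (0 : V3)) (fun _ => (1 : ℝ))) z := by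
    intro z hz
    unfold canonicalDensity
    rw [canonicalPartition_eq_posPartition continuous_const continuous_const continuous_const
        (fun _ => zero_le_one) (fun _ => one_pos), Set.indicator_of_mem (hBD hz)]
    have hprod : (∏ i, m i) ≤ tensorPow (N + 1)
        (localGibbsProfile (fun _ => (1 : ℝ)) (fun _ => (0 : V3)) (fun _ => (1 : ℝ))) z := by
      unfold tensorPow localGibbsProfile
      refine Finset.prod_le_prod (fun i _ => hm0 i) fun i _ => ?_
      rw [one_mul]
      exact localMaxwellian_ge_of_mem_ball (hz i).2
    have hT0 : 0 ≤ tensorPow (N + 1)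
        (localGibbsProfile (fun _ => (1 : ℝ)) (fun _ => (0 : V3)) (fun _ => (1 : ℝ))) z :=
      (Finset.prod_nonneg fun i _ => hm0 i).trans hprod
    calc (∏ i, m i) ≤ tensorPow (N + 1)
          (localGibbsProfile (fun _ => (1 : ℝ)) (fun _ => (0 : V3)) (fun _ => (1 : ℝ))) z := hprod
      _ = 1 * _ := (one_mul _).symm
      _ ≤ (posPartition (fun _ : T3 => (1 : ℝ)) (hsDiameter σ N) (N + 1))⁻¹ * _ :=
          mul_le_mul_of_nonneg_right (one_le_inv₀ hZpos |>.2 hZle) hT0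
  -- integrate
  have hvol : volume B = ∏ i, (ENNReal.ofReal (rx i) ^ 3 * ENNReal.ofReal (Real.pi * 4 / 3)) *
      (ENNReal.ofReal (rv i) ^ 3 * ENNReal.ofReal (Real.pi * 4 / 3)) := volume_templateBox p w rx rv hrx
  have hterm : ∀ i, ENNReal.ofReal (boxWeight (w i) (rx i) (rv i)) =
      ENNReal.ofReal (m i) * ((ENNReal.ofReal (rx i) ^ 3 * ENNReal.ofReal (Real.pi * 4 / 3)) *
        (ENNReal.ofReal (rv i) ^ 3 * ENNReal.ofReal (Real.pi * 4 / 3))) := by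
    intro i
    have h1 : (0 : ℝ) ≤ rx i ^ 3 * (Real.pi * 4 / 3) := by have := hrx0 i; positivity
    have h2 : (0 : ℝ) ≤ rv i ^ 3 * (Real.pi * 4 / 3) := by have := hrv0 i; positivity
    rw [← ENNReal.ofReal_pow (hrx0 i), ← ENNReal.ofReal_pow (hrv0 i),
      ← ENNReal.ofReal_mul (pow_nonneg (hrx0 i) 3), ← ENNReal.ofReal_mul (pow_nonneg (hrv0 i) 3),
      ← ENNReal.ofReal_mul h1, ← ENNReal.ofReal_mul (hm0 i)]
    congr 1
    simp only [boxWeight, hm]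
    ring
  have hbw0 : ∀ i, 0 ≤ boxWeight (w i) (rx i) (rv i) := by
    intro i
    have := hrx0 i; have := hrv0 i
    unfold boxWeight
    exact mul_nonneg (by positivity) (hm0 i)
  unfold gibbs
  rw [localGibbsLaw_eq, localGibbsMeasure, withDensity_apply _ hBm]
  calc ENNReal.ofReal (∏ i, boxWeight (w i) (rx i) (rv i))
      = ∏ i, ENNReal.ofReal (boxWeight (w i) (rx i) (rv i)) :=
        ENNReal.ofReal_prod_of_nonneg fun i _ => hbw0 i
    _ = ∏ i, ENNReal.ofReal (m i) * ((ENNReal.ofReal (rx i) ^ 3 * ENNReal.ofReal (Real.pi * 4 / 3)) *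
        (ENNReal.ofReal (rv i) ^ 3 * ENNReal.ofReal (Real.pi * 4 / 3))) :=
        Finset.prod_congr rfl fun i _ => hterm i
    _ = (∏ i, ENNReal.ofReal (m i)) * ∏ i, ((ENNReal.ofReal (rx i) ^ 3 * ENNReal.ofReal (Real.pi * 4 / 3)) *
        (ENNReal.ofReal (rv i) ^ 3 * ENNReal.ofReal (Real.pi * 4 / 3))) := Finset.prod_mul_distrib
    _ = ENNReal.ofReal (∏ i, m i) * volume B := by
        rw [ENNReal.ofReal_prod_of_nonneg (fun i _ => hm0 i), hvol]
    _ = ∫⁻ _z in B, ENNReal.ofReal (∏ i, m i) ∂volume := (setLIntegral_const _ _).symm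
    _ ≤ ∫⁻ z in B, ENNReal.ofReal (canonicalDensity (Torus.geometry (Fin 3)) (hsDiameter σ N) (N + 1)
          (localGibbsProfile (fun _ => (1 : ℝ)) (fun _ => (0 : V3)) (fun _ => (1 : ℝ))) z) ∂volume :=
        setLIntegral_mono' hBm fun z hz => ENNReal.ofReal_le_ofReal (hdens z hz)

/-! ## Cost arithmetic: `(N+1)! · ∏ boxWeight ≥ e^{-(C+κ)(N+1)}` -/

/-- `costKappa > 0`. -/
theorem costKappa_pos : 0 < costKappa := by
  unfold costKappa
  have : 0 < Real.log (2 * Real.pi) := Real.log_pos (by linarith [Real.pi_gt_three])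
  positivity

/-- Logarithmic lower bound of one slot weight. -/
theorem log_boxWeight_ge (w : V3) {rx rv : ℝ} (hrx : 0 < rx) (hrv : 0 < rv) (hrv1 : rv ≤ 1) :
    Real.log (rx ^ 3) + Real.log (rv ^ 3) - ‖w‖ ^ 2 - (3 / 2 * Real.log (2 * Real.pi) + 1) ≤
      Real.log (boxWeight w rx rv) := by
  have hpi : (1 : ℝ) ≤ Real.pi * 4 / 3 := by linarith [Real.pi_gt_three]
  have hpi0 : (0 : ℝ) < Real.pi * 4 / 3 := by linarith
  have h2pi : (0 : ℝ) < 2 * Real.pi := by positivity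
  have hx3 : 0 < rx ^ 3 := pow_pos hrx 3
  have hv3 : 0 < rv ^ 3 := pow_pos hrv 3
  have hrp : 0 < (2 * Real.pi) ^ (-(3 : ℝ) / 2) := Real.rpow_pos_of_pos h2pi _
  have hexp : 0 < Real.exp (-(‖w‖ + rv) ^ 2 / 2) := Real.exp_pos _
  have hlogpi : 0 ≤ Real.log (Real.pi * 4 / 3) := Real.log_nonneg hpi
  have hA : 0 < Real.pi * 4 / 3 * rx ^ 3 := mul_pos hpi0 hx3
  have hB : 0 < Real.pi * 4 / 3 * rv ^ 3 := mul_pos hpi0 hv3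
  have hC : 0 < (2 * Real.pi) ^ (-(3 : ℝ) / 2) * Real.exp (-(‖w‖ + rv) ^ 2 / 2) := mul_pos hrp hexp
  have e : Real.log (boxWeight w rx rv) =
      (Real.log (Real.pi * 4 / 3) + Real.log (rx ^ 3)) + (Real.log (Real.pi * 4 / 3) + Real.log (rv ^ 3)) +
        (-(3 : ℝ) / 2 * Real.log (2 * Real.pi) + -(‖w‖ + rv) ^ 2 / 2) := by
    unfold boxWeight
    rw [Real.log_mul (x := Real.pi * 4 / 3 * rx ^ 3 * (Real.pi * 4 / 3 * rv ^ 3)) (mul_pos hA hB).ne' hC.ne',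
      Real.log_mul (x := Real.pi * 4 / 3 * rx ^ 3) hA.ne' hB.ne',
      Real.log_mul (x := Real.pi * 4 / 3) (y := rx ^ 3) hpi0.ne' hx3.ne',
      Real.log_mul (x := Real.pi * 4 / 3) (y := rv ^ 3) hpi0.ne' hv3.ne',
      Real.log_mul (x := (2 * Real.pi) ^ (-(3 : ℝ) / 2)) hrp.ne' hexp.ne',
      Real.log_exp, Real.log_rpow h2pi]
  have hsq : (‖w‖ + rv) ^ 2 / 2 ≤ ‖w‖ ^ 2 + 1 := by
    have hrv2 : rv ^ 2 ≤ 1 := by nlinarith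
    nlinarith [sq_nonneg (‖w‖ - rv)]
  rw [e]
  nlinarith

/-- **The symmetrised Gibbs cost is exponential, not factorial**: `(N+1)! ∏ᵢ boxWeightᵢ ≥
e^{-(C + κ)(N+1)}` under the cost axiom (Stirling in the crude form `n^n ≤ eⁿ n!`). -/
theorem exp_le_factorial_mul_prod_boxWeight {N : ℕ} {w : Fin (N + 1) → V3}
    {rx rv : Fin (N + 1) → ℝ} {C : ℝ} (hrx : ∀ i, 0 < rx i) (hrv : ∀ i, 0 < rv i)
    (hrv1 : ∀ i, rv i ≤ 1)
    (hcost : ∑ i, (‖w i‖ ^ 2 - Real.log (((N + 1 : ℕ) : ℝ) * rx i ^ 3) - Real.log (rv i ^ 3)) ≤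
      C * (N + 1)) :
    Real.exp (-(C + costKappa) * (N + 1)) ≤
      ((N + 1).factorial : ℝ) * ∏ i, boxWeight (w i) (rx i) (rv i) := by
  have hbw : ∀ i, 0 < boxWeight (w i) (rx i) (rv i) := by
    intro i
    have := hrx i; have := hrv i
    unfold boxWeight
    have h2pi : (0 : ℝ) < 2 * Real.pi := by positivity
    have := Real.rpow_pos_of_pos h2pi (-(3 : ℝ) / 2)
    have : (0 : ℝ) < Real.pi * 4 / 3 := by linarith [Real.pi_gt_three]
    positivity
  have hprod : 0 < ∏ i, boxWeight (w i) (rx i) (rv i) := Finset.prod_pos fun i _ => hbw i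
  have hfact : (0 : ℝ) < ((N + 1).factorial : ℝ) := by exact_mod_cast Nat.factorial_pos _
  set n1 : ℝ := (N : ℝ) + 1 with hn1
  have hcast : ((N + 1 : ℕ) : ℝ) = n1 := by rw [hn1]; push_cast; ring
  have hN1 : (0 : ℝ) < n1 := by rw [hn1]; positivity
  -- Stirling, crude: `n log n ≤ log n! + n`
  have hstir : n1 * Real.log n1 ≤ Real.log ((N + 1).factorial : ℝ) + n1 := by
    have h := Real.pow_div_factorial_le_exp (x := n1) hN1.le (N + 1)
    have hpow : 0 < n1 ^ (N + 1) := pow_pos hN1 _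
    have h' := Real.log_le_log (div_pos hpow hfact) h
    rw [Real.log_div hpow.ne' hfact.ne', Real.log_pow, Real.log_exp, hcast] at h'
    linarith
  -- the cost, rewritten
  have hsum : -(C * n1) - n1 * Real.log n1 ≤
      ∑ i, (Real.log (rx i ^ 3) + Real.log (rv i ^ 3) - ‖w i‖ ^ 2) := by
    have hre : ∀ i, Real.log (((N + 1 : ℕ) : ℝ) * rx i ^ 3) =
        Real.log n1 + Real.log (rx i ^ 3) := fun i => by
      rw [hcast]; exact Real.log_mul hN1.ne' (pow_pos (hrx i) 3).ne'
    simp only [hre] at hcost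
    have hsplit : ∑ i, (‖w i‖ ^ 2 - (Real.log n1 + Real.log (rx i ^ 3)) - Real.log (rv i ^ 3)) +
        ∑ i, (Real.log (rx i ^ 3) + Real.log (rv i ^ 3) - ‖w i‖ ^ 2) = -(n1 * Real.log n1) := by
      rw [← Finset.sum_add_distrib]
      rw [Finset.sum_congr rfl fun i _ =>
        (show ‖w i‖ ^ 2 - (Real.log n1 + Real.log (rx i ^ 3)) - Real.log (rv i ^ 3) +
          (Real.log (rx i ^ 3) + Real.log (rv i ^ 3) - ‖w i‖ ^ 2) = -Real.log n1 by ring)]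
      rw [Finset.sum_const, Finset.card_univ, Fintype.card_fin, nsmul_eq_mul, hcast]
      ring
    have hc' : C * (N + 1) = C * n1 := by rw [hn1]
    rw [hc'] at hcost
    linarith
  -- the slot bounds, summed
  have hslots : ∑ i, (Real.log (rx i ^ 3) + Real.log (rv i ^ 3) - ‖w i‖ ^ 2) -
      n1 * (3 / 2 * Real.log (2 * Real.pi) + 1) ≤
      ∑ i, Real.log (boxWeight (w i) (rx i) (rv i)) := by
    have h := Finset.sum_le_sum (s := Finset.univ) fun i _ =>
      log_boxWeight_ge (w i) (hrx i) (hrv i) (hrv1 i)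
    rw [Finset.sum_sub_distrib, Finset.sum_const, Finset.card_univ, Fintype.card_fin,
      nsmul_eq_mul, hcast] at h
    exact h
  -- assemble in logarithms
  have hlog : -(C + costKappa) * (N + 1) ≤
      Real.log (((N + 1).factorial : ℝ) * ∏ i, boxWeight (w i) (rx i) (rv i)) := by
    rw [Real.log_mul hfact.ne' hprod.ne', Real.log_prod (fun i _ => (hbw i).ne')]
    rw [show -(C + costKappa) * (N + 1) = -(C + costKappa) * n1 by rw [hn1]]
    unfold costKappa
    nlinarith
  calc Real.exp (-(C + costKappa) * (N + 1))
      ≤ Real.exp (Real.log (((N + 1).factorial : ℝ) * ∏ i, boxWeight (w i) (rx i) (rv i))) :=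
        Real.exp_le_exp.2 hlog
    _ = _ := Real.exp_log (mul_pos hfact hprod)

/-! ## The symmetrised box and its Gibbs mass -/

/-- The symmetrised box is measurable. -/
theorem measurableSet_symBox {n : ℕ} (p : Fin n → T3) (w : Fin n → V3) (rx rv : Fin n → ℝ) :
    MeasurableSet (symBox p w rx rv) :=
  MeasurableSet.iUnion fun _ => measurableSet_templateBox _ _ _ _

/-- Distinct relabellings give disjoint boxes when the position balls are disjoint. -/
theorem disjoint_templateBox_relabel {n : ℕ} {p : Fin n → T3} (w : Fin n → V3) {rx : Fin n → ℝ}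
    (rv : Fin n → ℝ) (hsep : ∀ a b, a ≠ b → rx a + rx b < Torus.euclidDist (p a) (p b))
    {π π' : Equiv.Perm (Fin n)} (hne : π ≠ π') :
    Disjoint (templateBox (p ∘ π.symm) (w ∘ π.symm) (rx ∘ π.symm) (rv ∘ π.symm))
      (templateBox (p ∘ π'.symm) (w ∘ π'.symm) (rx ∘ π'.symm) (rv ∘ π'.symm)) := by
  rw [Set.disjoint_left]
  intro z hz hz'
  have hsymm : π.symm ≠ π'.symm := fun h => hne (by simpa using congrArg Equiv.symm h)
  obtain ⟨i, hi⟩ : ∃ i, π.symm i ≠ π'.symm i := by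
    by_contra hall
    push Not at hall
    exact hsymm (Equiv.ext hall)
  have h1 := (hz i).1
  have h2 := (hz' i).1
  simp only [Function.comp_apply] at h1 h2
  have htri := euclidDist_triangle (p (π.symm i)) (z i).1 (p (π'.symm i))
  rw [Torus.euclidDist_comm (p (π.symm i)) (z i).1] at htri
  linarith [hsep _ _ hi]

/-- **Mass of the symmetrised box**: `G_N(symBox) ≥ (N+1)! · ∏ᵢ boxWeightᵢ` (disjoint union of
`(N+1)!` relabelled boxes of equal mass bound). -/
theorem gibbs_symBox_ge {σ : ℝ} (hσ2 : σ ≤ 1 / 2) {N : ℕ} (Φ : Flow σ N)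
    {p : Fin (N + 1) → T3} {w : Fin (N + 1) → V3} {rx rv : Fin (N + 1) → ℝ}
    (hrx0 : ∀ i, 0 ≤ rx i) (hrx : ∀ i, rx i < 1 / 2) (hrv0 : ∀ i, 0 ≤ rv i)
    (hsep : ∀ i j, i ≠ j → hsDiameter σ N ≤ Torus.euclidDist (p i) (p j) - rx i - rx j)
    (hε : 0 < hsDiameter σ N) :
    ENNReal.ofReal (((N + 1).factorial : ℝ) * ∏ i, boxWeight (w i) (rx i) (rv i)) ≤
      gibbs σ 1 1 0 N Φ (symBox p w rx rv) := by
  have hdisj : Pairwise fun π π' : Equiv.Perm (Fin (N + 1)) =>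
      Disjoint (templateBox (p ∘ π.symm) (w ∘ π.symm) (rx ∘ π.symm) (rv ∘ π.symm))
        (templateBox (p ∘ π'.symm) (w ∘ π'.symm) (rx ∘ π'.symm) (rv ∘ π'.symm)) := by
    intro π π' hne
    refine disjoint_templateBox_relabel w rv (fun a b hab => ?_) hne
    have := hsep a b hab
    linarith
  have heach : ∀ π : Equiv.Perm (Fin (N + 1)),
      ENNReal.ofReal (∏ i, boxWeight (w i) (rx i) (rv i)) ≤
        gibbs σ 1 1 0 N Φ (templateBox (p ∘ π.symm) (w ∘ π.symm) (rx ∘ π.symm) (rv ∘ π.symm)) := by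
    intro π
    have h := gibbs_templateBox_ge hσ2 Φ (p := p ∘ π.symm) (w := w ∘ π.symm) (rx := rx ∘ π.symm)
      (rv := rv ∘ π.symm) (fun i => hrx0 _) (fun i => hrx _) (fun i => hrv0 _)
      (fun i j hij => hsep _ _ (π.symm.injective.ne hij))
    have hπ : ∏ i, boxWeight ((w ∘ π.symm) i) ((rx ∘ π.symm) i) ((rv ∘ π.symm) i) =
        ∏ i, boxWeight (w i) (rx i) (rv i) :=
      Equiv.prod_comp π.symm (fun i => boxWeight (w i) (rx i) (rv i))
    rw [hπ] at h
    exact h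
  unfold symBox
  rw [measure_iUnion hdisj (fun π => measurableSet_templateBox _ _ _ _), tsum_fintype]
  calc ENNReal.ofReal (((N + 1).factorial : ℝ) * ∏ i, boxWeight (w i) (rx i) (rv i))
      = ((N + 1).factorial : ℝ≥0∞) * ENNReal.ofReal (∏ i, boxWeight (w i) (rx i) (rv i)) := by
        rw [ENNReal.ofReal_mul (by positivity), ENNReal.ofReal_natCast]
    _ = ∑ _π : Equiv.Perm (Fin (N + 1)), ENNReal.ofReal (∏ i, boxWeight (w i) (rx i) (rv i)) := by
        rw [Finset.sum_const, Finset.card_univ, Fintype.card_perm, Fintype.card_fin, nsmul_eq_mul]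
    _ ≤ _ := Finset.sum_le_sum fun π _ => heach π


end

end Summit.AtomisticToContinuum.HydrodynamicLimit.Theorems.InfluenceLocality.Negative
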